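import Literature.NumberTheory.EllipticCurves.ManinConstantGamma1Gamma0Comparison
import HarnessLib

/-!
# The Manin constant of an optimal parametrisation is `±1` — Manin's conjecture (`Γ₀(N)`) and
# Stevens' conjecture (`Γ₁(N)`) as CLOSED `Prop` leaves (obligation nodes; nothing asserted)

Conjecture leaf of the summit `BirchSwinnertonDyer` (typing layer D-0088(4), seat bsd-littype-12,
paper of record Česnavičius–Neururer–Saha, *The Manin constant and the modular degree*, J. Eur.
Math. Soc. 26 (2024) 573–637). This module contains NOTHING but two `@[conjecture]` definitions, so
that Literature theorems "assuming Manin's conjecture" may import it; the proved edges (equivalence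
with the class-local predicate `ClassAbsManinConstantEqOne`, Manin ⟹ Stevens by ČNS Lemma 6.5, the
printed partial results by name) live in the sibling `Rank1Residual/ManinConstantOneEdges.lean`.

What is printed (version of record, §1, p. 574): "For fixed `Γ` and `E` there are many `φ`, so it is
common to normalize `φ` to be optimal, that is, `deg(φ)` to be the least possible as `E` varies in
its isogeny class and `Γ` is fixed (any `φ` factors through an optimal one …). For optimal `φ`, Manin
conjectured that `c_φ = ±1`, see [Man71, Section 10.3]" — with footnote 2: "Manin considered
`Γ = Γ₀(N)`, and this implies the general case by Lemma 6.5. In [Ste89], Stevens argued that minimal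
degree parametrizations by `X₁(N)_ℚ` are the most natural ones, and he conjectured that `c_φ = ±1`
for them." Here `φ^*(ω_E) = c_φ · ω_f` for a Néron differential `ω_E` ("`φ` determines only `±c_φ`").
Agashe–Ribet–Stein 2006, Conjecture 2.1 (Manin), p. 619: "We have `c_E = 1`" (`c_E = |c|` for the
optimal = strong Weil curve `E` of conductor `N` and its parametrisation `X₀(N) → E`).

Rendering (the tree's, used by EVERY typed Manin-constant theorem — `ManinConstantSemistablePrimewise`,
`ManinConstantConductorLe300000`, `AgasheRibetStein2006/…`, `ManinConstantClassCertificate`):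
a globally minimal model `W/ℚ` (so that `D.L` is the NÉRON lattice and `D.c` is the Manin constant
w.r.t. a Néron differential), a parametrisation datum `D : ModularParametrizationData W N`
(`ModularCurve.lean`: newform `f` of `W` on `Γ₀(N)`, Néron period pair `L`, `c ∈ ℤ` with
`c·Λ_f ⊆ Λ_W`, the degree) and the LATTICE CLAUSE `Λ_W = c·Λ_f` — "`Ker(J₀(N) ↠ E)` is connected",
i.e. `φ_D` is the optimal parametrisation (minimal degree ⟹ lattice clause is the tree theorem
`ModularParametrizationData.latticeEq_of_forall_modularDegree_le`; ČNS: "any `φ` factors through an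
optimal one"); conclusion `|D.maninConstant| = 1` (= "`c_φ = ±1`"). The `Γ₁(N)` twin uses
`Gamma1ParametrizationData W N` (`ManinConstantGamma1ModularDegree.lean`) and its lattice clause
`Gamma1ParametrizationData.IsOptimal` (`ManinConstantGamma1Gamma0Comparison.lean`).
Level: `D.f` is a newform of `W` at level `N`, so `N` is the conductor (strong multiplicity one,
`IsNewformOf.level_eq_conductorNorm_of_exists_isNewformOf`); quantifying over all `N` is the
convention of `ClassAbsManinConstantEqOne` and of the range facts `cremona_…_le_500000` etc.

Status in print (ČNS §1, pp. 574–575): OPEN. Known: `p ∤ c` for semistable `p` (Mazur `p > 2`,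
Česnavičius 2018 all `p`; tree `cesnavicius2018_not_dvd_maninConstant_of_not_sq_dvd_level`), for
`p ≥ 11` outside additive potentially ordinary reduction of Kodaira type II, III, IV (Edixhoven 1991
Thm. 3; tree `ManinConstantNonPotentiallyOrdinaryPrimes`/`…KodairaTypePrimes`), `c = ±1` for
`N ≤ 500000` (Cremona, as cited loc. cit.; tree `cremona_abs_maninConstant_eq_one_of_level_le_500000`),
`c ∣ 6·deg φ` and `c ∣ deg φ` for cube-free `N` (ČNS Thm. 1.2; tree `cesnaviciusNeururerSaha_thm_1_2`);
for `X₁(N)`: `c ∣ deg φ` (ČNS Thm. 1.1; tree `cesnaviciusNeururerSaha_thm_1_1`) and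
`c_{Γ₁} ∣ c_{Γ₀}` (ČNS Lemma 6.5; tree `cesnaviciusNeururerSaha_lemma_6_5_dvd`).
No `sorry`, no instance, no notation, no Literature fact introduced. PARTITION (D-0054): none —
typing layer; consumers = every `r ≤ 1` road carrying a Manin datum `p ∤ c(D)` (b2b-bsdres X12 and
additive classes, K5/bsd-eis GV00 "up to the Manin constant" via Stevens' curve).
-/

set_option autoImplicit false

noncomputable section

open WeierstrassCurve Literature.NumberTheory.EllipticCurves
  Literature.NumberTheory.EllipticCurves.ModularForms

namespace Summit.BirchSwinnertonDyer.Rank1Residual.ManinConstant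

/-- **Manin's conjecture (1971)** — Česnavičius–Neururer–Saha, JEMS 26 (2024), §1 p. 574: "For
optimal `φ`, Manin conjectured that `c_φ = ±1`, see [Man71, Section 10.3]" (`Γ = Γ₀(N)`, footnote 2);
Agashe–Ribet–Stein 2006, Conjecture 2.1 (Manin): "We have `c_E = 1`". Rendering (module docstring):
for every globally minimal `W/ℚ`, every level `N ≥ 1` and every `X₀(N)`-parametrisation datum `D`
of `W` satisfying the lattice clause `Λ_W = c·Λ_f` (= `φ_D` optimal), `|D.maninConstant| = 1`.
An OPEN PROBLEM — obligation node, nothing asserted; not a Literature fact.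
[cite: CesnaviciusNeururerSaha2023, §1 p. 574 with fn. 2 (statement of [Man71, §10.3]; nothing asserted)]
[cite: AgasheRibetStein2006, Conjecture 2.1 (p. 619; nothing asserted)] -/
@[conjecture] def ManinConstantOne : Prop :=
  ∀ (W : WeierstrassCurve ℚ) [W.IsElliptic] [W.IsGloballyMinimal] {N : ℕ} [NeZero N]
    (D : ModularParametrizationData W N),
    (∀ z ∈ D.L.lattice, ∃ w ∈ periodLattice D.f, z = D.c * w) → |D.maninConstant| = 1

/-- **Stevens' conjecture (1989) on `X₁(N)`-parametrisations** — Česnavičius–Neururer–Saha, JEMS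
26 (2024), §1 p. 574, footnote 2: "In [Ste89], Stevens argued that minimal degree parametrizations
by `X₁(N)_ℚ` are the most natural ones, and he conjectured that `c_φ = ±1` for them"
([Ste89] = Stevens, Invent. Math. 98 (1989) 75–106). Rendering: for every globally minimal `W/ℚ`,
every `N ≥ 1` and every `X₁(N)`-datum `D : Gamma1ParametrizationData W N` satisfying the lattice
clause `D.IsOptimal` (`Λ_W = c·Λ₁(f)`, "`Ker(J₁(N) ↠ E)` connected" = `φ_D` is the minimal-degree
`X₁(N)`-parametrisation of the class), `|D.maninConstant| = 1`. An OPEN PROBLEM — obligation node,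
nothing asserted; not a Literature fact. (Manin ⟹ Stevens by ČNS Lemma 6.5: sibling edges file.)
[cite: CesnaviciusNeururerSaha2023, §1 p. 574 fn. 2 (statement of [Ste89]; nothing asserted)] -/
@[conjecture] def StevensConstantOne : Prop :=
  ∀ (W : WeierstrassCurve ℚ) [W.IsElliptic] [W.IsGloballyMinimal] {N : ℕ} [NeZero N]
    (D : Gamma1ParametrizationData W N), D.IsOptimal → |D.maninConstant| = 1

end Summit.BirchSwinnertonDyer.Rank1Residual.ManinConstant

end
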